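import Mathlib.Tactic
import HarnessLib
import HarnessLib.Audit.Tags
import Summits.CriticalPhenomena.PercolationContinuityZ3.Theorems.PercNearOneGluingNoHeavyLowerTailSahiAntichainSplitSeven

/-!
# Antichains, meets plus joins: two members above a three-member sunflower with at most one new meet give five new joins (statement S)

Support file (seat `prim-masterthm-p1`, gen 37; `--supports stmt-CriticalPhenomena-4575`).  No `sorry`, no new definitions, standard
axioms.  Memo `run/shared/lean/prim/prim-masterthm/FROM-prim-masterthm-p1-g37-LINEAR-REDUCTION.md` §8.3/§9.1.

SETTING: L3 (`f(5) ≥ 10`) ⟸ H23 ⟸ three residual statements (S), (C), (F) (`h23_of`, `…TwoThreeA`).  This file proves **(S)**: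
at a point with exactly two members `a, a'` above and a three-member SUNFLOWER (core `K`) below, `#newMeets ≤ 1 ⟹ #newJoins ≥ 5`.

PROOF.  The only old meet is `K`, so a cross meet containing a point outside `K` is new.  (1) If a member `g` above meets the petals of two
different members below, their two cross meets are new and distinct — so each `g` meets at most one petal, and then `g ∪ b ≠ g ∪ b'` for
all `b ≠ b'` below (a petal point of an un-met member separates them): each row has three distinct cross joins.  (2) The two rows are disjoint:
`a ∪ b = a' ∪ b'` would put `a \\ a'` inside `b'` and `a' \\ a` inside `b`; a point of `a \\ a'` in the core makes every `a' ∩ b''` new (it misses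
that core point), hence all equal, and every `a ∩ b''` old, and then a point of `a' \\ a` lies in the core `K = a ∩ b ⊆ a` — absurd; symmetrically;
and if both separating points are petal points, `a ∩ b'` and `a' ∩ b` are two new meets which would have to coincide, putting `a \\ a'` into `a'`.
(3) Six distinct cross joins, at most one of which is the old join `a ∪ a'`.  Complete atom census (memo §9.1): `#newMeets ≤ 1` occurs at such
points only with `#newJoins ∈ {5, 6}`.
HONEST FRAMING: unconditional; (C), (F), L4 and hence L3-in-Lean, V5 remain OPEN. [this work]
-/

namespace Summit.CriticalPhenomena.PercolationContinuityZ3.Theorems.SahiColouredDaykin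

open Finset

variable {α : Type*} [DecidableEq α]

/-- **(S)**: two members above, a three-member sunflower below, at most one new meet ⟹ at least five new joins. [this work] -/
theorem five_le_card_newJoins_of_two_sunflower_three {P : Finset (Finset α)} {r : α} {K : Finset α}
    (hanti : IsAntichain (· ⊆ ·) (P : Set (Finset α))) (h2 : #(above P r) = 2) (h3 : #(below P r) = 3)
    (hK : ∀ b ∈ below P r, ∀ b' ∈ below P r, b ≠ b' → b ∩ b' = K) (hx : #(newMeets P r) ≤ 1) :
    5 ≤ #(newJoins P r) := by
  obtain ⟨a, a', hne, hA⟩ := card_eq_two.1 h2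
  have ha : a ∈ above P r := by rw [hA]; simp
  have ha' : a' ∈ above P r := by rw [hA]; simp
  obtain ⟨haP, hra⟩ := mem_above_iff.1 ha
  obtain ⟨ha'P, hra'⟩ := mem_above_iff.1 ha'
  have hJ : joins (above P r) = {a ∪ a'} := by rw [hA, joins_pair hne]
  have hB2 : 1 < #(below P r) := by omega
  -- core and petals of the sunflower below
  have hKsub : ∀ {b : Finset α}, b ∈ below P r → K ⊆ b := by
    intro b hb
    obtain ⟨b', hb', hbb'⟩ := exists_mem_ne hB2 b
    rw [← hK b hb b' hb' hbb'.symm]; exact inter_subset_left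
  have hcore : ∀ {b b' : Finset α}, b ∈ below P r → b' ∈ below P r → b ≠ b' → ∀ {x}, x ∈ b → x ∈ b' → x ∈ K := by
    intro b b' hb hb' hbb' x hx hx'
    rw [← hK b hb b' hb' hbb']; exact mem_inter.2 ⟨hx, hx'⟩
  have hpetal : ∀ {b b' : Finset α}, b ∈ below P r → b' ∈ below P r → b ≠ b' → ∃ p ∈ b, p ∉ b' ∧ p ∉ K := by
    intro b b' hb hb' hbb'
    have : ¬ b ⊆ b' := hanti (mem_coe.2 (below_subset P r hb)) (mem_coe.2 (below_subset P r hb')) hbb'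
    obtain ⟨p, hpb, hpb'⟩ := not_subset.1 this
    exact ⟨p, hpb, hpb', fun hpK => hpb' (hKsub hb' hpK)⟩
  -- the only old meet is `K`; a cross meet with a point outside `K` is new
  have hold : ∀ Z ∈ meets (below P r), Z = K := by
    intro Z hZ
    obtain ⟨d, hd, d', hd', hdd', rfl⟩ := mem_meets_iff.1 hZ
    exact hK d hd d' hd' hdd'
  have newM : ∀ {g b : Finset α} {p : α}, g ∈ above P r → b ∈ below P r → p ∈ g → p ∈ b → p ∉ K → g ∩ b ∈ newMeets P r := by
    intro g b p hg hb hpg hpb hpK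
    rw [inter_mem_newMeets_iff hg hb]
    intro h
    have := hold _ h
    exact hpK (by rw [← this]; exact mem_inter.2 ⟨hpg, hpb⟩)
  have uniq : ∀ {Z Z' : Finset α}, Z ∈ newMeets P r → Z' ∈ newMeets P r → Z = Z' :=
    fun hZ hZ' => card_le_one.1 hx _ hZ _ hZ'
  -- (1) a member above meets at most one petal; hence its three cross joins are pairwise distinct
  have touch1 : ∀ {g b b' : Finset α} {p q : α}, g ∈ above P r → b ∈ below P r → b' ∈ below P r → b ≠ b' →
      p ∈ g → p ∈ b → p ∉ K → q ∈ g → q ∈ b' → q ∉ K → False := by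
    intro g b b' p q hg hb hb' hbb' hpg hpb hpK hqg hqb' hqK
    have h := uniq (newM hg hb hpg hpb hpK) (newM hg hb' hqg hqb' hqK)
    have : p ∈ g ∩ b' := by rw [← h]; exact mem_inter.2 ⟨hpg, hpb⟩
    exact hpK (hcore hb hb' hbb' hpb (mem_inter.1 this).2)
  have rowdist : ∀ {g b b' : Finset α}, g ∈ above P r → b ∈ below P r → b' ∈ below P r → b ≠ b' → g ∪ b ≠ g ∪ b' := by
    intro g b b' hg hb hb' hbb' heq
    obtain ⟨p, hpb, hpb', hpK⟩ := hpetal hb hb' hbb'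
    obtain ⟨q, hqb', hqb, hqK⟩ := hpetal hb' hb hbb'.symm
    -- `p ∈ g ∪ b = g ∪ b'` forces `p ∈ g`; likewise `q ∈ g`; then `g` meets both petals
    have hpg : p ∈ g := by
      have : p ∈ g ∪ b' := by rw [← heq]; exact mem_union_right _ hpb
      rcases mem_union.1 this with h | h
      · exact h
      · exact absurd h hpb'
    have hqg : q ∈ g := by
      have : q ∈ g ∪ b := by rw [heq]; exact mem_union_right _ hqb'
      rcases mem_union.1 this with h | h
      · exact h
      · exact absurd h hqb
    exact touch1 hg hb hb' hbb' hpg hpb hpK hqg hqb' hqK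
  -- (2) the two rows of cross joins are disjoint
  have naa' : ¬ a ⊆ a' := hanti (mem_coe.2 haP) (mem_coe.2 ha'P) hne
  have na'a : ¬ a' ⊆ a := hanti (mem_coe.2 ha'P) (mem_coe.2 haP) hne.symm
  obtain ⟨s, hsa, hsa'⟩ := not_subset.1 naa'
  obtain ⟨t, hta', hta⟩ := not_subset.1 na'a
  have rows : ∀ {b b' : Finset α}, b ∈ below P r → b' ∈ below P r → a ∪ b ≠ a' ∪ b' := by
    intro b b' hb hb' heq
    have hsb' : s ∈ b' := by
      have : s ∈ a' ∪ b' := by rw [← heq]; exact mem_union_left _ hsa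
      rcases mem_union.1 this with h | h
      · exact absurd h hsa'
      · exact h
    have htb : t ∈ b := by
      have : t ∈ a ∪ b := by rw [heq]; exact mem_union_left _ hta'
      rcases mem_union.1 this with h | h
      · exact absurd h hta
      · exact h
    -- a separating point in the core makes one whole row new (hence constant) and the other row old
    have coreCase : ∀ {g g' : Finset α} {z w : α} {c : Finset α}, g ∈ above P r → g' ∈ above P r → z ∈ g → z ∉ g' → z ∈ K →
        w ∈ g' → w ∉ g → c ∈ below P r → w ∈ c → False := by
      intro g g' z w c hg hg' hzg hzg' hzK hwg' hwg hc hwc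
      -- every `g' ∩ b''` misses `z ∈ K`, hence is new; so they all coincide
      have newrow : ∀ {b'' : Finset α}, b'' ∈ below P r → g' ∩ b'' ∈ newMeets P r := by
        intro b'' hb''
        rw [inter_mem_newMeets_iff hg' hb'']
        intro h
        have := hold _ h
        have : z ∈ g' ∩ b'' := by rw [this]; exact hzK
        exact hzg' (mem_inter.1 this).1
      -- `w ∈ g' ∩ c`, so `w` lies in every `g' ∩ b''`, hence in two members below, hence in `K`
      obtain ⟨c', hc', hcc'⟩ := exists_mem_ne hB2 c
      have hwc' : w ∈ c' := by
        have h := uniq (newrow hc) (newrow hc')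
        have : w ∈ g' ∩ c' := by rw [← h]; exact mem_inter.2 ⟨hwg', hwc⟩
        exact (mem_inter.1 this).2
      have hwK : w ∈ K := hcore hc hc' hcc'.symm hwc hwc'
      -- every `g ∩ b''` contains `z`, so is not the new meet; hence it is old, `= K`, and `w ∈ K ⊆ g ∩ c ⊆ g`
      have hgc : g ∩ c = K := by
        by_contra hneK
        have hnew : g ∩ c ∈ newMeets P r := by
          rw [inter_mem_newMeets_iff hg hc]
          intro h; exact hneK (hold _ h)
        have h := uniq hnew (newrow hc)
        have : z ∈ g' ∩ c := by rw [← h]; exact mem_inter.2 ⟨hzg, hKsub hc hzK⟩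
        exact hzg' (mem_inter.1 this).1
      have : w ∈ g ∩ c := by rw [hgc]; exact hwK
      exact hwg (mem_inter.1 this).1
    by_cases hsK : s ∈ K
    · exact coreCase ha ha' hsa hsa' hsK hta' hta hb htb
    by_cases htK : t ∈ K
    · exact coreCase ha' ha hta' hta htK hsa hsa' hb' hsb'
    · -- both separating points are petal points: two new meets `a ∩ b' ∋ s` and `a' ∩ b ∋ t` coincide, so `s ∈ a'`
      have h := uniq (newM ha hb' hsa hsb' hsK) (newM ha' hb hta' htb htK)
      have : s ∈ a' ∩ b := by rw [← h]; exact mem_inter.2 ⟨hsa, hsb'⟩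
      exact hsa' (mem_inter.1 this).1
  -- (3) count: six distinct cross joins, at most one equal to `a ∪ a'`
  have injA : Set.InjOn (fun b => a ∪ b) (below P r : Set (Finset α)) := by
    intro b hb b' hb' h; by_contra hbb; exact rowdist ha (mem_coe.1 hb) (mem_coe.1 hb') hbb h
  have injA' : Set.InjOn (fun b => a' ∪ b) (below P r : Set (Finset α)) := by
    intro b hb b' hb' h; by_contra hbb; exact rowdist ha' (mem_coe.1 hb) (mem_coe.1 hb') hbb h
  have hdisj : Disjoint ((below P r).image fun b => a ∪ b) ((below P r).image fun b => a' ∪ b) := by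
    rw [disjoint_left]
    intro W hW hW'
    obtain ⟨b, hb, rfl⟩ := mem_image.1 hW
    obtain ⟨b', hb', heq'⟩ := mem_image.1 hW'
    exact rows hb hb' heq'.symm
  have hsub : ((below P r).image (fun b => a ∪ b) ∪ (below P r).image (fun b => a' ∪ b)).erase (a ∪ a') ⊆ newJoins P r := by
    intro W hW
    obtain ⟨hWu, hW⟩ := mem_erase.1 hW
    rcases mem_union.1 hW with hW | hW
    · obtain ⟨b, hb, rfl⟩ := mem_image.1 hW
      rw [union_mem_newJoins_iff ha hb, hJ, mem_singleton]; exact hWu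
    · obtain ⟨b, hb, rfl⟩ := mem_image.1 hW
      rw [union_mem_newJoins_iff ha' hb, hJ, mem_singleton]; exact hWu
  have h6 : #((below P r).image (fun b => a ∪ b) ∪ (below P r).image (fun b => a' ∪ b)) = 6 := by
    rw [card_union_of_disjoint hdisj, card_image_of_injOn injA, card_image_of_injOn injA', h3]
  have := card_le_card hsub
  have h5 := pred_card_le_card_erase (s := (below P r).image (fun b => a ∪ b) ∪ (below P r).image (fun b => a' ∪ b)) (a := a ∪ a')
  omega

end Summit.CriticalPhenomena.PercolationContinuityZ3.Theorems.SahiColouredDaykin
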